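import Literature.MathematicalPhysics.QuantumFieldTheory.Balaban1983to89.B1Sect3Statements
import Literature.Analysis.Calculus.TaylorSegmentWithin

/-!
# `Balaban1983to89.B1Eq362TaylorRemainder` — T. Bałaban, *(Higgs)₂,₃ quantum fields in a finite volume. I. A lower
bound*, Commun. Math. Phys. **85** (1982) 603–626 [Balaban1982Higgs1], (3.62)–(3.63) p. 624 [PDF 22]:
**the one-sided perturbative sum `Σ_{0≦α+β≦n̄} (1/(α!β!)) e^αλ^β (∂^{α+β}/∂e′^α∂λ′^β) E(e′,λ′)|_{e′=λ′=0}`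
(r12's decl of record `B1Sect3Statements.pertSum362R`, the shape of (3.36)/(3.62)) IS THE ORDER-`n̄` TAYLOR POLYNOMIAL of
the two-variable generating function `E`, with an explicit LAGRANGE REMAINDER**, for EVERY `E : ℝ → ℝ → ℝ` of class
`C^{n̄+1}` jointly in `(e′, λ′)` on a slab `ℝ × [0, δ]` (the `λ′`-derivatives one-sided at `0`, as in `pertSum362R`):
for all `(e, λ) ∈ ℝ × [0, δ]` there is `θ ∈ (0, 1)` with
`E(e, λ) = pertSum362R E e λ n̄ + ((n̄+1)!)⁻¹ D^{n̄+1}_{ℝ×[0,δ]}E(θe, θλ)((e,λ), …, (e,λ))`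
(`eq_pertSum362R_add_remainder`).  The print, verbatim (p. 624, after (3.62); render paper I p022):
*"Because we take here an expansion until the order n̄ only, so in (3.61) we can take a whole function E_k instead of its
expansion until the order n̄"* … *"where E′ is an expression given by the formula (3.61) only instead of the Taylor
expansion of the function E_k in the exponent we have the function E_k(…) itself"* — this file supplies the calculus
fact behind the words *"Taylor expansion … until the order n̄"*: the difference between the whole function and the sum
(3.62)/(3.36) is a genuine `(n̄+1)`-st order Taylor remainder.  The instance `E = E_k` of part III (1.4) is
`B3Eq15TaylorRemainder.auxE_eq_pertSum362R_add_remainder` (typer g28, proved first; this file is its abstraction to the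
generating function of r12's rows).

statement-level skeleton of published theorems with citation tags; proofs where landed; nothing here is a claim about
the Yang–Mills mass gap

THE ARGUMENT (ours; calculus, all generic pieces in `Literature/Analysis/Calculus/`): Taylor–Lagrange along the segment
from `(0,0)` to `(e,λ)` WITHIN the convex slab (`taylor_lagrange_segment_within`, Coleman Thm. 5.3), the binomial
expansion of the SYMMETRIC multilinear maps `D^i_{ℝ×[0,δ]}E(0,0)` (Schwarz within the slab at the endpoint,
`iteratedFDerivWithin_comp_perm_of_mem_closure_interior`; `map_const_add_smul_eq_sum_choose_of_symmetric`, Coleman App.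
Ch. 5) on `(e,λ) = e(1,0) + λ(0,1)`, the identification of the entries `D^i((1,0)^α,(0,1)^{i−α})` with the iterated
one-sided partials `∂^α_{e′}[∂^{i−α}_{λ′,[0,∞)}E(e′,·)(0)](0)` (`iteratedDeriv_iteratedDerivWithin_slice_eq_append`, Coleman
§4.5), and the re-indexing `(i, α) ↦ (α, β = i − α)` onto the index set of `pertSum362R`.

WHAT IS PROVED (theorems only; no definition, no `Prop` fact; axioms standard), for `E : ℝ → ℝ → ℝ`, `δ > 0`,
`S = univ ×ˢ [0, δ]`, `Ẽ(p) = E(p.1, p.2)`: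
* **`iteratedDeriv_slice_eq_iteratedFDerivWithin`** (`Ẽ ∈ C^n(S)`, `α + β ≤ n`):
  `∂^α_{e′}[∂^β_{λ′,[0,∞)}E(e′,·)(0)](e₀) = D^{α+β}_S Ẽ(e₀, 0)((1,0)^α, (0,1)^β)`;
* **`iteratedFDerivWithin_slab_comp_perm`** (`m ≤ n`, `t ∈ [0, δ]`): `D^m_S Ẽ(e₀, t)` is symmetric;
* **`iteratedFDerivWithin_diagonal_eq_sum`** (`i ≤ n`):
  `D^i_S Ẽ(0,0)((e,λ)^i) = Σ_{α≤i} C(i,α) e^α λ^{i−α} ∂^α_{e′}[∂^{i−α}_{λ′,[0,∞)}E(e′,·)(0)](0)`;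
* **`taylor_diagonal`** (`Ẽ ∈ C^{n̄+1}(S)`, `λ ∈ [0, δ]`): `E(e,λ) = Σ_{i≤n̄}(i!)⁻¹D^i_S Ẽ(0,0)((e,λ)^i) + ((n̄+1)!)⁻¹D^{n̄+1}_S Ẽ(θe,θλ)((e,λ)^{n̄+1})`;
* **`eq_pertSum362R_add_remainder`** (`Ẽ ∈ C^{n̄+1}(S)`, `λ ∈ [0, δ]`): the headline;
* **`abs_sub_pertSum362R_le`** (same, `‖D^{n̄+1}_S Ẽ(θe,θλ)‖ ≤ C` on `θ ∈ (0,1)`): `|E(e,λ) − pertSum362R E e λ n̄| ≤ ((n̄+1)!)⁻¹ C ‖(e,λ)‖^{n̄+1}`;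
* **`exists_abs_sub_pertSum362R_le`** (`Ẽ ∈ C^{n̄+1}(S)`, any `R`): `∃ C, ∀ |e| ≤ R, λ ∈ [0,δ], |E(e,λ) − pertSum362R E e λ n̄| ≤ C ‖(e,λ)‖^{n̄+1}`.
HONEST SCOPE: a calculus identity (and the remainder bound it implies for a SUPPLIED derivative bound `C`) for a
SUPPLIED jointly `C^{n̄+1}` function of the two couplings; which `E` of the papers satisfies the hypothesis is
established elsewhere (part III (1.4): `B3Eq15JointSmooth`); no `C` is computed here.

PDF held: `paper:balaban1982-cmp85-higgs23-i` (journal page = PDF page + 602); p. 624 [PDF 22] read from the render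
`run/shared/lean/pub/pub-balaban/b2b-balaban-ref1/pages/1982-cmp85-higgs23-I/1982-cmp85-higgs23-I-p022-x2.png`.

CITATION HEADER (lean-in-tree rule).  lit-balaban TYPED SKELETON (HOME `run/shared/lean/pub/lit-balaban/`), rows
**B1.Eq3.62-3.63** and **B1.Eq3.36** (owner r12, `lit-balaban-r12/ROWS-B1-part2.md`; decl of record
`B1Sect3Statements.pertSum362R`, v1.1 one-sided reading); unit `lit-balaban-typer` (literature-prover-lit-balaban-typer-g28-0).
Nothing of any other seat is touched; no row changes head (a located calculus member for the cells, r12's call).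
-/

namespace Literature.MathematicalPhysics.QuantumFieldTheory.Balaban1983to89.B1Eq362TaylorRemainder

open Literature.Analysis.Calculus
  (iteratedDeriv_iteratedDerivWithin_slice_eq_append iteratedFDerivWithin_comp_perm_of_mem_closure_interior
    taylor_lagrange_segment_within map_const_add_smul_eq_sum_choose_of_symmetric)
open Set Filter Topology
open scoped BigOperators ContDiff

noncomputable section

/-- Near every `u < δ` the sets `[0, ∞)` and `[0, δ]` coincide, so iterated derivatives within them agree at `u`.
[folklore] -/
private theorem iteratedDerivWithin_Ici_eq_Icc {f : ℝ → ℝ} {δ u : ℝ} (hu : u < δ) (n : ℕ) :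
    iteratedDerivWithin n f (Set.Ici 0) u = iteratedDerivWithin n f (Set.Icc 0 δ) u := by
  have h : Set.Ici (0 : ℝ) =ᶠ[𝓝 u] Set.Icc 0 δ := by
    filter_upwards [Iio_mem_nhds hu] with x hx
    simp only [eq_iff_iff]
    exact ⟨fun h => ⟨h, (Set.mem_Iio.1 hx).le⟩, fun h => h.1⟩
  rw [iteratedDerivWithin_eq_iteratedFDerivWithin, iteratedDerivWithin_eq_iteratedFDerivWithin,
    iteratedFDerivWithin_congr_set h]

/-- **Re-indexing a double Taylor sum**: summing `F(α, i − α)` over `α ≤ i ≤ n` is summing `F(α, β)` over the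
pairs with `α + β ≤ n` (both coordinates `≤ n`) — the index set of `B1Sect3Statements.pertSum362R`. [folklore] -/
private theorem sum_range_sum_range_eq_sum_filter_add_le {X : Type*} [AddCommMonoid X] (F : ℕ → ℕ → X) (n : ℕ) :
    ∑ i ∈ Finset.range (n + 1), ∑ α ∈ Finset.range (i + 1), F α (i - α)
      = ∑ ab ∈ (Finset.range (n + 1) ×ˢ Finset.range (n + 1)).filter (fun ab => ab.1 + ab.2 ≤ n),
          F ab.1 ab.2 := by
  have hset : (Finset.range (n + 1) ×ˢ Finset.range (n + 1)).filter (fun ab : ℕ × ℕ => ab.1 + ab.2 ≤ n)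
      = (Finset.range (n + 1)).biUnion (fun i => Finset.HasAntidiagonal.antidiagonal i) := by
    ext ⟨a, b⟩
    simp only [Finset.mem_filter, Finset.mem_product, Finset.mem_range, Finset.mem_biUnion,
      Finset.HasAntidiagonal.mem_antidiagonal]
    constructor
    · rintro ⟨-, h⟩; exact ⟨a + b, by omega, rfl⟩
    · rintro ⟨i, hi, h⟩; omega
  have hdisj : Set.PairwiseDisjoint (↑(Finset.range (n + 1)) : Set ℕ)
      (fun i => Finset.HasAntidiagonal.antidiagonal i) := by
    intro i _ i' _ hne
    refine Finset.disjoint_left.2 fun p hp hp' => hne ?_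
    rw [Finset.HasAntidiagonal.mem_antidiagonal] at hp hp'
    rw [← hp, ← hp']
  rw [hset, Finset.sum_biUnion hdisj]
  refine Finset.sum_congr rfl fun i _ => ?_
  exact (Finset.Nat.sum_antidiagonal_eq_sum_range_succ (fun a b => F a b) i).symm

/-- For `h : α + β = i` the block tuple `(u^α, v^{i−α})` on `Fin i` is the concatenation `(u^α, v^β)`, and the
corresponding entries of `D^i_S Φ` and `D^{α+β}_S Φ` agree. [folklore] -/
private theorem iteratedFDerivWithin_block_eq_append {X : Type*} [NormedAddCommGroup X] [NormedSpace ℝ X]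
    (Φ : X → ℝ) (S : Set X) (p : X) (u v : X) {α β i : ℕ} (h : α + β = i) :
    iteratedFDerivWithin ℝ i Φ S p (fun j : Fin i => if (j : ℕ) < α then u else v)
      = iteratedFDerivWithin ℝ (α + β) Φ S p (Fin.append (fun _ : Fin α => u) (fun _ : Fin β => v)) := by
  subst h
  congr 1
  funext j
  refine Fin.addCases (fun l => ?_) (fun l => ?_) j
  · rw [Fin.append_left, if_pos (by rw [Fin.val_castAdd]; exact l.isLt)]
  · rw [Fin.append_right, if_neg (by rw [Fin.val_natAdd]; omega)]

variable {E : ℝ → ℝ → ℝ} {δ : ℝ}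

/-- **`∂^α_{e′}[∂^β_{λ′,[0,∞)}E(e′, ·)(0)](e₀) = D^{α+β}_{ℝ×[0,δ]}E(e₀, 0)((1,0)^α, (0,1)^β)`** for `E` jointly `C^n` within
the slab `ℝ × [0, δ]` (`δ > 0`) and `α + β ≤ n`: the iterated slice derivatives entering `pertSum362R` (one-sided in
`λ′` within `[0, ∞)` at `0`, then two-sided in `e′`) are the entries of the joint Fréchet derivative within the slab.
[cite: Balaban1982Higgs1, (3.62) p.624] -/
theorem iteratedDeriv_slice_eq_iteratedFDerivWithin (hδ : 0 < δ) {n : WithTop ℕ∞}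
    (hE : ContDiffOn ℝ n (fun p : ℝ × ℝ => E p.1 p.2) (Set.univ ×ˢ Set.Icc 0 δ)) {α β : ℕ}
    (hαβ : ((α + β : ℕ) : WithTop ℕ∞) ≤ n) (e₀ : ℝ) :
    iteratedDeriv α (fun e' => iteratedDerivWithin β (fun l' => E e' l') (Set.Ici 0) 0) e₀
      = iteratedFDerivWithin ℝ (α + β) (fun p : ℝ × ℝ => E p.1 p.2) (Set.univ ×ˢ Set.Icc 0 δ) (e₀, 0)
          (Fin.append (fun _ => ((1 : ℝ), (0 : ℝ))) (fun _ => ((0 : ℝ), (1 : ℝ)))) := by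
  have e : (fun e' => iteratedDerivWithin β (fun l' => E e' l') (Set.Ici 0) 0)
      = fun e' => iteratedDerivWithin β (fun s => (fun p : ℝ × ℝ => E p.1 p.2) (e', s)) (Set.Icc 0 δ) 0 := by
    funext e'
    exact iteratedDerivWithin_Ici_eq_Icc hδ β
  rw [e]
  exact iteratedDeriv_iteratedDerivWithin_slice_eq_append hE (uniqueDiffOn_Icc hδ) hαβ e₀ ⟨le_rfl, hδ.le⟩

/-- **`D^m_{ℝ×[0,δ]}E(e₀, t)` IS SYMMETRIC** for `E` jointly `C^n` within the slab, `m ≤ n`, `t ∈ [0, δ]` (endpoints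
included): Schwarz's theorem within the slab. [cite: Balaban1982Higgs1, (3.62) p.624] -/
theorem iteratedFDerivWithin_slab_comp_perm (hδ : 0 < δ) {n : WithTop ℕ∞}
    (hE : ContDiffOn ℝ n (fun p : ℝ × ℝ => E p.1 p.2) (Set.univ ×ˢ Set.Icc 0 δ)) {m : ℕ}
    (hm : (m : WithTop ℕ∞) ≤ n) (e₀ : ℝ) {t : ℝ} (ht : t ∈ Set.Icc (0 : ℝ) δ) (v : Fin m → ℝ × ℝ)
    (σ : Equiv.Perm (Fin m)) :
    iteratedFDerivWithin ℝ m (fun p : ℝ × ℝ => E p.1 p.2) (Set.univ ×ˢ Set.Icc 0 δ) (e₀, t) (v ∘ σ)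
      = iteratedFDerivWithin ℝ m (fun p : ℝ × ℝ => E p.1 p.2) (Set.univ ×ˢ Set.Icc 0 δ) (e₀, t) v := by
  have hx' : ((e₀, t) : ℝ × ℝ) ∈ closure (interior (Set.univ ×ˢ Set.Icc (0 : ℝ) δ : Set (ℝ × ℝ))) := by
    rw [interior_prod_eq, interior_univ, closure_prod_eq, closure_univ, interior_Icc, closure_Ioo hδ.ne]
    exact ⟨Set.mem_univ _, ht⟩
  exact iteratedFDerivWithin_comp_perm_of_mem_closure_interior hE (uniqueDiffOn_univ.prod (uniqueDiffOn_Icc hδ)) hm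
    ⟨Set.mem_univ _, ht⟩ hx' v σ

/-- **THE DIAGONAL VALUES `D^i_{ℝ×[0,δ]}E(0,0)((e,λ), …, (e,λ))` ARE THE WEIGHTED ITERATED ONE-SIDED PARTIALS**:
`= Σ_{α=0}^{i} C(i,α) e^α λ^{i−α} · ∂^α_{e′}[∂^{i−α}_{λ′,[0,∞)}E(e′,·)(0)](0)` (`E` jointly `C^n` within the slab, `i ≤ n`;
binomial expansion of the symmetric `i`-linear map on `e(1,0) + λ(0,1)`). [cite: Balaban1982Higgs1, (3.62) p.624] -/
theorem iteratedFDerivWithin_diagonal_eq_sum (hδ : 0 < δ) {n : WithTop ℕ∞}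
    (hE : ContDiffOn ℝ n (fun p : ℝ × ℝ => E p.1 p.2) (Set.univ ×ˢ Set.Icc 0 δ)) {i : ℕ}
    (hi : (i : WithTop ℕ∞) ≤ n) (e lam : ℝ) :
    iteratedFDerivWithin ℝ i (fun p : ℝ × ℝ => E p.1 p.2) (Set.univ ×ˢ Set.Icc 0 δ) (0, 0) (fun _ => (e, lam))
      = ∑ α ∈ Finset.range (i + 1), ((i.choose α : ℝ) * e ^ α * lam ^ (i - α))
          * iteratedDeriv α (fun e' => iteratedDerivWithin (i - α) (fun l' => E e' l') (Set.Ici 0) 0) 0 := by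
  have hsymm := iteratedFDerivWithin_slab_comp_perm hδ hE hi 0 (t := 0) ⟨le_rfl, hδ.le⟩
  have hpt : (fun _ : Fin i => ((e, lam) : ℝ × ℝ)) = fun _ => e • ((1 : ℝ), (0 : ℝ)) + lam • ((0 : ℝ), (1 : ℝ)) := by
    funext j
    rw [Prod.smul_mk, Prod.smul_mk, Prod.mk_add_mk, smul_eq_mul, smul_eq_mul, smul_eq_mul, smul_eq_mul, mul_one,
      mul_zero, mul_zero, mul_one, add_zero, zero_add]
  rw [hpt, map_const_add_smul_eq_sum_choose_of_symmetric _ hsymm]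
  refine Finset.sum_congr rfl fun α hα => ?_
  have hαi : α ≤ i := Nat.lt_succ_iff.1 (Finset.mem_range.1 hα)
  have hαβ : ((α + (i - α) : ℕ) : WithTop ℕ∞) ≤ n := by rw [Nat.add_sub_cancel' hαi]; exact hi
  rw [smul_eq_mul, iteratedFDerivWithin_block_eq_append _ _ _ _ _ (Nat.add_sub_cancel' hαi),
    ← iteratedDeriv_slice_eq_iteratedFDerivWithin hδ hE hαβ 0]

/-- **TAYLOR–LAGRANGE IN DIAGONAL FORM on the slab**: for `E` jointly `C^{n̄+1}` within `ℝ × [0, δ]` (`δ > 0`) and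
`λ ∈ [0, δ]` there is `θ ∈ (0, 1)` with
`E(e, λ) = Σ_{i ≤ n̄} (i!)⁻¹ D^i_{ℝ×[0,δ]}E(0,0)((e,λ)^i) + ((n̄+1)!)⁻¹ D^{n̄+1}_{ℝ×[0,δ]}E(θe, θλ)((e,λ)^{n̄+1})`
(Coleman Thm. 5.3 within the convex slab). [cite: Balaban1982Higgs1, (3.62) p.624] -/
theorem taylor_diagonal (hδ : 0 < δ) {nbar : ℕ}
    (hE : ContDiffOn ℝ ((nbar + 1 : ℕ) : WithTop ℕ∞) (fun p : ℝ × ℝ => E p.1 p.2) (Set.univ ×ˢ Set.Icc 0 δ))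
    {e lam : ℝ} (hlam : lam ∈ Set.Icc (0 : ℝ) δ) :
    ∃ θ ∈ Set.Ioo (0 : ℝ) 1,
      E e lam
        = ∑ i ∈ Finset.range (nbar + 1),
            ((i.factorial : ℝ))⁻¹ * iteratedFDerivWithin ℝ i (fun p : ℝ × ℝ => E p.1 p.2)
              (Set.univ ×ˢ Set.Icc 0 δ) (0, 0) (fun _ => (e, lam))
          + (((nbar + 1).factorial : ℝ))⁻¹ * iteratedFDerivWithin ℝ (nbar + 1) (fun p : ℝ × ℝ => E p.1 p.2)
              (Set.univ ×ˢ Set.Icc 0 δ) (θ * e, θ * lam) (fun _ => (e, lam)) := by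
  have hS : UniqueDiffOn ℝ (Set.univ ×ˢ Set.Icc (0 : ℝ) δ : Set (ℝ × ℝ)) :=
    uniqueDiffOn_univ.prod (uniqueDiffOn_Icc hδ)
  have hSc : Convex ℝ (Set.univ ×ˢ Set.Icc (0 : ℝ) δ : Set (ℝ × ℝ)) := convex_univ.prod (convex_Icc 0 δ)
  have h0 : ((0 : ℝ), (0 : ℝ)) ∈ (Set.univ ×ˢ Set.Icc (0 : ℝ) δ : Set (ℝ × ℝ)) :=
    ⟨Set.mem_univ _, ⟨le_rfl, hδ.le⟩⟩
  have hx : ((0 : ℝ), (0 : ℝ)) + (e, lam) ∈ (Set.univ ×ˢ Set.Icc (0 : ℝ) δ : Set (ℝ × ℝ)) := by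
    rw [Prod.mk_add_mk, zero_add, zero_add]
    exact ⟨Set.mem_univ _, hlam⟩
  obtain ⟨θ, hθ, h⟩ := taylor_lagrange_segment_within hS hSc hE h0 hx
  refine ⟨θ, hθ, ?_⟩
  rw [Prod.mk_add_mk, zero_add, zero_add, Prod.smul_mk, smul_eq_mul, smul_eq_mul, Prod.mk_add_mk, zero_add,
    zero_add] at h
  exact h

/-- **(3.62)/(3.36) IS THE ORDER-`n̄` TAYLOR POLYNOMIAL WITH A LAGRANGE REMAINDER**: for every `E : ℝ → ℝ → ℝ` jointly
`C^{n̄+1}` within the slab `ℝ × [0, δ]` (`δ > 0`) and every `(e, λ)` with `λ ∈ [0, δ]` there is `θ ∈ (0, 1)` with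
`E(e, λ) = pertSum362R E e λ n̄ + ((n̄+1)!)⁻¹ D^{n̄+1}_{ℝ×[0,δ]}E(θe, θλ)((e,λ), …, (e,λ))`, where
`pertSum362R E e λ n̄ = Σ_{0≦α+β≦n̄} (α!β!)⁻¹ e^α λ^β ∂^α_{e′}[∂^β_{λ′,[0,∞)}E(e′,·)(0)](0)` is r12's one-sided reading of
the printed sum — *"an expansion until the order n̄ only"*, *"the Taylor expansion of the function E_k"* (p. 624).
[cite: Balaban1982Higgs1, (3.62)–(3.63) p.624] -/
theorem eq_pertSum362R_add_remainder (hδ : 0 < δ) {nbar : ℕ}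
    (hE : ContDiffOn ℝ ((nbar + 1 : ℕ) : WithTop ℕ∞) (fun p : ℝ × ℝ => E p.1 p.2) (Set.univ ×ˢ Set.Icc 0 δ))
    {e lam : ℝ} (hlam : lam ∈ Set.Icc (0 : ℝ) δ) :
    ∃ θ ∈ Set.Ioo (0 : ℝ) 1,
      E e lam
        = B1Sect3Statements.pertSum362R E e lam nbar
          + (((nbar + 1).factorial : ℝ))⁻¹ * iteratedFDerivWithin ℝ (nbar + 1) (fun p : ℝ × ℝ => E p.1 p.2)
              (Set.univ ×ˢ Set.Icc 0 δ) (θ * e, θ * lam) (fun _ => (e, lam)) := by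
  obtain ⟨θ, hθ, h⟩ := taylor_diagonal hδ hE hlam
  refine ⟨θ, hθ, ?_⟩
  rw [h]
  congr 1
  have hterm : ∀ i ∈ Finset.range (nbar + 1),
      ((i.factorial : ℝ))⁻¹ * iteratedFDerivWithin ℝ i (fun p : ℝ × ℝ => E p.1 p.2)
          (Set.univ ×ˢ Set.Icc 0 δ) (0, 0) (fun _ => (e, lam))
        = ∑ α ∈ Finset.range (i + 1),
            1 / ((α.factorial : ℝ) * ((i - α).factorial : ℝ)) * e ^ α * lam ^ (i - α)
              * iteratedDeriv α (fun e' => iteratedDerivWithin (i - α) (fun l' => E e' l') (Set.Ici 0) 0) 0 := by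
    intro i hi
    have hi' : (i : WithTop ℕ∞) ≤ ((nbar + 1 : ℕ) : WithTop ℕ∞) := by
      exact_mod_cast (Finset.mem_range.1 hi).le
    rw [iteratedFDerivWithin_diagonal_eq_sum hδ hE hi' e lam, Finset.mul_sum]
    refine Finset.sum_congr rfl fun α hα => ?_
    have hαi : α ≤ i := Nat.lt_succ_iff.1 (Finset.mem_range.1 hα)
    have hfac : (i.factorial : ℝ) = (i.choose α : ℝ) * (α.factorial : ℝ) * ((i - α).factorial : ℝ) := by
      rw [← Nat.choose_mul_factorial_mul_factorial hαi]
      push_cast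
      ring
    have hα0 : (α.factorial : ℝ) ≠ 0 := by exact_mod_cast α.factorial_ne_zero
    have hβ0 : ((i - α).factorial : ℝ) ≠ 0 := by exact_mod_cast (i - α).factorial_ne_zero
    have hc0 : (i.choose α : ℝ) ≠ 0 := by exact_mod_cast (Nat.choose_pos hαi).ne'
    rw [hfac]
    field_simp
  rw [Finset.sum_congr rfl hterm, B1Sect3Statements.pertSum362R]
  exact sum_range_sum_range_eq_sum_filter_add_le
    (fun α β => 1 / ((α.factorial : ℝ) * (β.factorial : ℝ)) * e ^ α * lam ^ β
      * iteratedDeriv α (fun e' => iteratedDerivWithin β (fun l' => E e' l') (Set.Ici 0) 0) 0) nbar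

/-- **REMAINDER BOUND** (Coleman Thm. 5.2 form): if `‖D^{n̄+1}_{ℝ×[0,δ]}E(θe, θλ)‖ ≤ C` along the open segment
`θ ∈ (0, 1)`, then `|E(e, λ) − pertSum362R E e λ n̄| ≤ ((n̄+1)!)⁻¹ · C · ‖(e, λ)‖^{n̄+1}` (`‖(e, λ)‖ = max(|e|, |λ|)`, the
product norm): the sum (3.62)/(3.36) approximates the whole function to order `n̄ + 1` in the couplings — *"an expansion
until the order n̄ only"* (p. 624). [cite: Balaban1982Higgs1, (3.62)–(3.63) p.624] -/
theorem abs_sub_pertSum362R_le (hδ : 0 < δ) {nbar : ℕ}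
    (hE : ContDiffOn ℝ ((nbar + 1 : ℕ) : WithTop ℕ∞) (fun p : ℝ × ℝ => E p.1 p.2) (Set.univ ×ˢ Set.Icc 0 δ))
    {e lam : ℝ} (hlam : lam ∈ Set.Icc (0 : ℝ) δ) {C : ℝ}
    (hC : ∀ θ ∈ Set.Ioo (0 : ℝ) 1, ‖iteratedFDerivWithin ℝ (nbar + 1) (fun p : ℝ × ℝ => E p.1 p.2)
        (Set.univ ×ˢ Set.Icc 0 δ) (θ * e, θ * lam)‖ ≤ C) :
    |E e lam - B1Sect3Statements.pertSum362R E e lam nbar|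
      ≤ (((nbar + 1).factorial : ℝ))⁻¹ * C * ‖((e, lam) : ℝ × ℝ)‖ ^ (nbar + 1) := by
  obtain ⟨θ, hθ, h⟩ := eq_pertSum362R_add_remainder hδ hE hlam
  rw [h, add_sub_cancel_left, abs_mul, abs_inv, Nat.abs_cast, mul_assoc]
  refine mul_le_mul_of_nonneg_left ?_ (inv_nonneg.2 (Nat.cast_nonneg _))
  have hop := ContinuousMultilinearMap.le_opNorm (iteratedFDerivWithin ℝ (nbar + 1) (fun p : ℝ × ℝ => E p.1 p.2)
    (Set.univ ×ˢ Set.Icc 0 δ) (θ * e, θ * lam)) (fun _ => ((e, lam) : ℝ × ℝ))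
  rw [Finset.prod_const, Finset.card_univ, Fintype.card_fin] at hop
  rw [← Real.norm_eq_abs]
  exact hop.trans (mul_le_mul_of_nonneg_right (hC θ hθ) (pow_nonneg (norm_nonneg _) _))

/-- **UNIFORM `O(‖(e, λ)‖^{n̄+1})` ON BOXES**: for `E` jointly `C^{n̄+1}` within the slab `ℝ × [0, δ]` and every `R`
there is `C` with `|E(e, λ) − pertSum362R E e λ n̄| ≤ C ‖(e, λ)‖^{n̄+1}` for all `|e| ≤ R`, `λ ∈ [0, δ]` (continuity of
`D^{n̄+1}_S Ẽ` on the compact box `[−R, R] × [0, δ]`, star-shaped about the origin, and `abs_sub_pertSum362R_le`): the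
sum (3.62)/(3.36) IS the expansion of `E` *"until the order n̄"* (p. 624). [cite: Balaban1982Higgs1, (3.62)–(3.63) p.624] -/
theorem exists_abs_sub_pertSum362R_le (hδ : 0 < δ) {nbar : ℕ}
    (hE : ContDiffOn ℝ ((nbar + 1 : ℕ) : WithTop ℕ∞) (fun p : ℝ × ℝ => E p.1 p.2) (Set.univ ×ˢ Set.Icc 0 δ))
    (R : ℝ) :
    ∃ C : ℝ, ∀ e ∈ Set.Icc (-R) R, ∀ lam ∈ Set.Icc (0 : ℝ) δ,
      |E e lam - B1Sect3Statements.pertSum362R E e lam nbar| ≤ C * ‖((e, lam) : ℝ × ℝ)‖ ^ (nbar + 1) := by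
  have hS : UniqueDiffOn ℝ (Set.univ ×ˢ Set.Icc (0 : ℝ) δ : Set (ℝ × ℝ)) :=
    uniqueDiffOn_univ.prod (uniqueDiffOn_Icc hδ)
  have hcont : ContinuousOn
      (iteratedFDerivWithin ℝ (nbar + 1) (fun p : ℝ × ℝ => E p.1 p.2) (Set.univ ×ˢ Set.Icc 0 δ))
      (Set.univ ×ˢ Set.Icc (0 : ℝ) δ) :=
    hE.continuousOn_iteratedFDerivWithin le_rfl hS
  have hK : IsCompact (Set.Icc (-R) R ×ˢ Set.Icc (0 : ℝ) δ) := isCompact_Icc.prod isCompact_Icc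
  have hKS : Set.Icc (-R) R ×ˢ Set.Icc (0 : ℝ) δ ⊆ (Set.univ ×ˢ Set.Icc (0 : ℝ) δ : Set (ℝ × ℝ)) :=
    Set.prod_mono (Set.subset_univ _) Set.Subset.rfl
  obtain ⟨B, hB⟩ := hK.exists_bound_of_continuousOn (hcont.mono hKS)
  refine ⟨(((nbar + 1).factorial : ℝ))⁻¹ * B, fun e he lam hlam => ?_⟩
  refine abs_sub_pertSum362R_le hδ hE hlam fun θ hθ => hB _ ⟨?_, ?_⟩
  · have hR : 0 ≤ R := by linarith [he.1, he.2]
    constructor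
    · nlinarith [mul_nonneg (sub_nonneg.2 he.1) hθ.1.le, mul_nonneg (sub_nonneg.2 hθ.2.le) hR]
    · nlinarith [mul_nonneg (sub_nonneg.2 he.2) hθ.1.le, mul_nonneg (sub_nonneg.2 hθ.2.le) hR]
  · exact ⟨mul_nonneg hθ.1.le hlam.1, (mul_le_of_le_one_left hlam.1 hθ.2.le).trans hlam.2⟩

end

end Literature.MathematicalPhysics.QuantumFieldTheory.Balaban1983to89.B1Eq362TaylorRemainder
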